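import Summits.CriticalPhenomena.PercolationContinuityZ3.Theorems.PercNearOneGluingNoHeavyQuantChemicalSphereWindow
import Literature.Probability.Percolation.PercolationSteepness
import HarnessLib

/-!
# A TWO-SIDED DIFFERENTIAL INEQUALITY FOR THE INTRINSIC VOLUME: `((1−p)^{2d−1}/p)·(V_p(r) − 1) ≤ dV_p(r)/dp` (every `p`, `r`, `d`)
# to go with gen 38's `dV_p(r)/dp ≤ (r/p)·V_p(r)`; integrated, `V_q(r) − 1 ≤ (V_p(r) − 1)·e^{−4(p−q)(1−p)^{2d}}` (`q ≤ p`), and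
# above `p_c`, `V_p(r) − 1 ≥ r·e^{4(p−p_c)(1−p)^{2d}}` — quant lane, seat p4 gen 39, file 6 (census V151)

builds on p205010 (kernel theorem, internal audit signed; external expert review pending) — NOT used in this file.
Seat `prim-quant-p4`, `--supports stmt-CriticalPhenomena-4575`; pure proofs, no definitions (`local notation3` only).

`V_p(r) = E_p|B_int(0,r)| = Σ_{z∈Λ_r} P_p(z ∈ B_int(0,r))`.  Each event `{z ∈ B_int(0,r)}` is increasing and determined by the lattice
edges touching `Λ_r` (`ChemSphere.determinedBy_mem_ball_touching`), so Grimmett–Piza's EXPONENTIAL STEEPNESS (tree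
`Steepness.real_mul_meanHamDist_le_deriv`, Grimmett 2006 Thm (2.53): `P_p(A)·E_p[H_A] ≤ p(1−p)·dP_p(A)/dp`) applies with the Hamming
distance bounded below by its first layer, `E_p[H_A] ≥ 1 − P_p(A)`, and `1 − P_p(z ∈ B_int(0,r)) ≥ (1−p)^{2d}` for `z ≠ 0`
(all `2d` edges at `z` closed).

* §1 `ChemSphere.meanHamDist_ge_one_sub_real` (`E_p[H_A^F] ≥ 1 − P_p(A)` for non-empty `F`), `ChemSphere.edgesTouching_box_nonempty`,
  **`ChemSphere.real_mem_ball_le_one_sub_pow`** (`P_p(z ∈ B_int(0,r)) ≤ 1 − (1−p)^{2d}`, `z ≠ 0`).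
* §2 **`ChemSphere.hasDerivAt_real_mem_ball_ge`** — for `z ≠ 0`, `p ∈ (0,1)`: the Russo derivative `D_z` of `q ↦ P_q(z ∈ B_int(0,r))`
  satisfies `P_p(z ∈ B_int(0,r))·(1−p)^{2d−1}/p ≤ D_z`; **`ChemSphere.hasDerivAt_sumBall_ge`** — `q ↦ V_q(r)` has a derivative `D` at
  `p` with **`((1−p)^{2d−1}/p)·(V_p(r) − 1) ≤ D`** (the upper companion `D ≤ (r/p)V_p(r)` is gen 38's closing-pivotal steepness
  `ChemRad.real_ball_le_pow_mul_real_ball`, there in integrated form).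
* §3 **`ChemSphere.sumBall_sub_one_le_mul_exp`** — `V_q(r) − 1 ≤ (V_p(r) − 1)·exp(−4(p−q)(1−p)^{2d})` for `0 < q ≤ p < 1`
  (Grimmett–Piza (2.56) summed over `z ≠ 0`); **`ChemSphere.sumBall_supercritical_ge_mul_exp`** — for `p_c ≤ p < 1`, `d ≥ 2`:
  `V_p(r) − 1 ≥ r·exp(4(p−p_c)(1−p)^{2d})` (file 2's `V_{p_c}(r) ≥ r + 1`).

HONEST STATUS.  NEW AS TYPED, elementary (Grimmett–Piza + finite energy); MF-INEXACT: on the forward tree `dV_p(r)/dp = p^{-1}Σ_k k(bp)^k`,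
so the lower side loses the factor `k` and the growth rate `4(1−p)^{2d}` is `r`-independent (the true excess volume grows like
`(p/q)^{≥1}`).  Recorded as the two-sided closure of census V151; NO rate, NO exponent for `d = 3`; (T1)/(T2) and the lane's honest
sentence UNCHANGED.

References: G. Grimmett, The Random-Cluster Model (2006) Thm (2.53), (2.54)–(2.56) [GrimmettRandomCluster2006]; G. R. Grimmett,
M. S. T. Piza, CMP 189 (1997) [GrimmettPiza1997]; G. Grimmett, Percolation (1999) §2.7 p. 52 [GrimmettPercolation1999].
-/

noncomputable section

namespace Summit.CriticalPhenomena.PercolationContinuityZ3.Theorems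

open MeasureTheory Set Filter Topology Literature.Probability.Percolation Literature.Probability.LatticeModels
open Literature.Probability.Percolation.Chemical Literature.Probability.Percolation.DCT16
open scoped Classical

namespace ChemSphere

variable {d : ℕ}

/-- `V_p(r) = Σ_{z ∈ Λ_r} P_p(z ∈ B_int(0,r)) = E_p|B_int(0,r)|`. -/
local notation3 "SB[" p ", " r "]" =>
  ∑ z ∈ box d r, (bondPercolation (zdGraph d) p).real {ω : BondConfig (Site d) | z ∈ ball (zdGraph d) 0 r ω}

/-- `A_z(r) = {z ∈ B_int(0,r)}`. -/
local notation3 "BALL[" z ", " r "]" => {ω : BondConfig (Site d) | z ∈ ball (zdGraph d) 0 r ω}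

/-- `F_r` = the lattice edges touching `Λ_r`. -/
local notation3 "ET[" r "]" => edgesTouching (zdGraph d) (box d r)

/-- `PR q` = the projection of a real parameter to `[0,1]`. -/
local notation3 "PR" => Set.projIcc (0 : ℝ) 1 zero_le_one

/-! ### §1. The first layer of the Hamming distance and finite energy at `z` -/

/-- **`E_p[H_A^F] ≥ 1 − P_p(A)`** for `F` non-empty: the layer `k = 0` of the layer cake (`{H_A^F ≤ 0} = A`).
[cite: GrimmettRandomCluster2006, (2.51)–(2.52)] -/
theorem meanHamDist_ge_one_sub_real {V : Type*} (G : SimpleGraph V) {F : Finset (Sym2 V)} (hF : F.Nonempty)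
    (A : Set (BondConfig V)) (p : unitInterval) :
    1 - (bondPercolation G p).real A ≤ Steepness.meanHamDist G F A p := by
  unfold Steepness.meanHamDist
  have h0 : 0 ∈ Finset.range F.card := Finset.mem_range.2 (Finset.card_pos.2 hF)
  calc 1 - (bondPercolation G p).real A = 1 - (bondPercolation G p).real (Steepness.withinDist F A 0) := by
        rw [Steepness.withinDist_zero]
    _ ≤ ∑ k ∈ Finset.range F.card, (1 - (bondPercolation G p).real (Steepness.withinDist F A k)) :=
        Finset.single_le_sum (f := fun k => 1 - (bondPercolation G p).real (Steepness.withinDist F A k))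
          (fun k _ => by linarith [measureReal_le_one (μ := bondPercolation G p) (s := Steepness.withinDist F A k)]) h0

/-- The lattice edges touching `Λ_r` are edges of `ℤ^d`. [folklore] -/
theorem edgesTouching_box_subset (r : ℕ) : (↑(ET[r]) : Set (Sym2 (Site d))) ⊆ (zdGraph d).edgeSet :=
  fun _ he => (mem_edgesTouching_iff.1 he).1

/-- For `d ≥ 1` the edge `{0, e₁}` touches `Λ_r`: `F_r` is non-empty. [folklore] -/
theorem edgesTouching_box_nonempty (hd : 1 ≤ d) (r : ℕ) : (ET[r]).Nonempty := by
  refine ⟨s((0 : Site d), Pi.single (⟨0, hd⟩ : Fin d) 1), mem_edgesTouching_iff.2 ⟨?_, 0, zero_mem_box d r, Sym2.mem_mk_left _ _⟩⟩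
  rw [SimpleGraph.mem_edgeSet]
  exact (zdGraph_adj_iff _ _).2 ⟨⟨0, hd⟩, Or.inl (by rw [zero_add])⟩

/-- **Finite energy at `z`: `P_p(z ∈ B_int(0,r)) ≤ 1 − (1−p)^{2d}` for `z ≠ 0`** — if all `2d` edges at `z` are closed, `z` is in no
intrinsic ball of the origin. [folklore] -/
theorem real_mem_ball_le_one_sub_pow (p : unitInterval) {z : Site d} (hz : z ≠ 0) (r : ℕ) :
    (bondPercolation (zdGraph d) p).real BALL[z, r] ≤ 1 - (1 - (p : ℝ)) ^ (2 * d) := by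
  set μ := bondPercolation (zdGraph d) p with hμ
  set I := (zdGraph d).incidenceFinset z with hI
  have hcard : I.card = 2 * d := by
    rw [hI, SimpleGraph.card_incidenceFinset_eq_degree, ← SimpleGraph.card_neighborFinset_eq_degree]
    exact card_neighborFinset_zdGraph_holds z
  have hclosed : (1 - (p : ℝ)) ^ (2 * d) ≤ μ.real {ω : BondConfig (Site d) | ∀ e ∈ I, e ∉ ω} := by
    rw [← hcard]; exact le_bondPercolation_real_forall_notMem (zdGraph d) p I
  -- the two events are disjoint
  have hdisj : Disjoint BALL[z, r] {ω : BondConfig (Site d) | ∀ e ∈ I, e ∉ ω} := by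
    rw [Set.disjoint_left]
    rintro ω ⟨w, -⟩ hcl
    -- the last edge of a walk from `0` to `z ≠ 0` is an open lattice edge at `z`
    have hne : ¬ w.Nil := by
      rw [← SimpleGraph.Walk.length_eq_zero_iff]
      exact fun h0 => hz ((SimpleGraph.Walk.eq_of_length_eq_zero h0)).symm
    have hy : (openGraph ω ⊓ zdGraph d).Adj w.penultimate z := w.adj_penultimate hne
    set y := w.penultimate with hydef
    have hadj := (SimpleGraph.inf_adj _ _ _ _).1 hy
    have hopen : s(y, z) ∈ ω := ((openGraph_adj ω y z).1 hadj.1).1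
    have hmem : s(y, z) ∈ I := by
      rw [hI, SimpleGraph.mem_incidenceFinset]
      exact ⟨(SimpleGraph.mem_edgeSet _).2 hadj.2, Sym2.mem_mk_right _ _⟩
    exact hcl _ hmem hopen
  have hsum : μ.real BALL[z, r] + μ.real {ω : BondConfig (Site d) | ∀ e ∈ I, e ∉ ω} ≤ 1 := by
    rw [← measureReal_union hdisj (determinedBy_forall_notMem I).measurableSet_of_finset]
    exact measureReal_le_one
  linarith

/-! ### §2. The lower differential inequality -/

/-- **Per site**: for `z ≠ 0` and `p ∈ (0,1)`, `q ↦ P_q(z ∈ B_int(0,r))` has Russo derivative `D_z ≥ 0` at `p` with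
`P_p(z ∈ B_int(0,r))·(1−p)^{2d−1}/p ≤ D_z` (Grimmett–Piza (2.54) with `E_p[H] ≥ 1 − P_p ≥ (1−p)^{2d}`).
[cite: GrimmettRandomCluster2006, Thm. (2.53) eq. (2.54)] -/
theorem hasDerivAt_real_mem_ball_ge (hd : 1 ≤ d) {z : Site d} (hz : z ≠ 0) (r : ℕ) {p : ℝ} (hp : p ∈ Set.Ioo (0 : ℝ) 1) :
    ∃ D : ℝ, HasDerivAt (fun q : ℝ => (bondPercolation (zdGraph d) (PR q)).real BALL[z, r]) D p ∧ 0 ≤ D ∧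
      (bondPercolation (zdGraph d) (PR p)).real BALL[z, r] * ((1 - p) ^ (2 * d - 1) / p) ≤ D := by
  obtain ⟨hD, hle⟩ := Steepness.real_mul_meanHamDist_le_deriv (G := zdGraph d) (edgesTouching_box_subset r)
    (isUpperSet_mem_ball z r) (determinedBy_mem_ball_touching z r) hp
  refine ⟨_, hD, Finset.sum_nonneg fun _ _ => measureReal_nonneg, ?_⟩
  set P := (bondPercolation (zdGraph d) (PR p)).real BALL[z, r] with hP
  set D := ∑ e ∈ ET[r], (bondPercolation (zdGraph d) (PR p)).real {ω | IsPivotal BALL[z, r] e ω} with hDdef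
  have hpv : ((PR p : unitInterval) : ℝ) = p := congrArg Subtype.val (Set.projIcc_of_mem zero_le_one ⟨hp.1.le, hp.2.le⟩)
  have hH : 1 - P ≤ Steepness.meanHamDist (zdGraph d) (ET[r]) BALL[z, r] (PR p) :=
    meanHamDist_ge_one_sub_real (zdGraph d) (edgesTouching_box_nonempty hd r) _ _
  have hfe : (1 - p) ^ (2 * d) ≤ 1 - P := by
    have := real_mem_ball_le_one_sub_pow (d := d) (PR p) hz r
    rw [hpv] at this; rw [hP]; linarith
  have hP0 : 0 ≤ P := measureReal_nonneg
  -- `P (1-p)^{2d} ≤ P (1 − P) ≤ P·E[H] ≤ p(1−p) D`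
  have h1 : P * (1 - p) ^ (2 * d) ≤ p * (1 - p) * D :=
    (mul_le_mul_of_nonneg_left (hfe.trans hH) hP0).trans hle
  have hd' : 2 * d = (2 * d - 1) + 1 := by omega
  rw [hd', pow_succ] at h1
  have h1p : 0 < 1 - p := by linarith [hp.2]
  rw [mul_div_assoc', div_le_iff₀ hp.1]
  nlinarith [h1, h1p]

/-- **THE LOWER DIFFERENTIAL INEQUALITY FOR THE INTRINSIC VOLUME**: for `p ∈ (0,1)`, `d ≥ 1`, every `r`, `q ↦ V_q(r) = E_q|B_int(0,r)|`
has a derivative `D` at `p` (Russo, term by term) with **`((1−p)^{2d−1}/p)·(V_p(r) − 1) ≤ D`** (the site `z = 0` contributes `1` to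
`V` and `0` to `D`).  Companion upper bound `D ≤ (r/p)V_p(r)`: gen 38 (`ChemRad.real_ball_le_pow_mul_real_ball`, integrated form).
[cite: GrimmettRandomCluster2006, Thm. (2.53) eq. (2.54)] -/
theorem hasDerivAt_sumBall_ge (hd : 1 ≤ d) (r : ℕ) {p : ℝ} (hp : p ∈ Set.Ioo (0 : ℝ) 1) :
    ∃ D : ℝ, HasDerivAt (fun q : ℝ => SB[PR q, r]) D p ∧
      ((1 - p) ^ (2 * d - 1) / p) * (SB[PR p, r] - 1) ≤ D := by
  -- per-site derivatives (at `z = 0` the event is sure and the derivative is that of a constant)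
  have hzero : ∀ q : ℝ, (bondPercolation (zdGraph d) (PR q)).real BALL[(0 : Site d), r] = 1 := fun q => by
    have : BALL[(0 : Site d), r] = Set.univ := Set.eq_univ_of_forall fun ω => self_mem_ball _ _ _ _
    rw [this, probReal_univ]
  have key : ∀ z : Site d, ∃ D : ℝ, HasDerivAt (fun q : ℝ => (bondPercolation (zdGraph d) (PR q)).real BALL[z, r]) D p ∧
      (if z = 0 then (0 : ℝ) else (bondPercolation (zdGraph d) (PR p)).real BALL[z, r] * ((1 - p) ^ (2 * d - 1) / p)) ≤ D := by
    intro z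
    by_cases hz : z = 0
    · subst hz
      refine ⟨0, ?_, by simp⟩
      have : (fun q : ℝ => (bondPercolation (zdGraph d) (PR q)).real BALL[(0 : Site d), r]) = fun _ => (1 : ℝ) := funext hzero
      rw [this]; exact hasDerivAt_const p 1
    · obtain ⟨D, hD, -, hge⟩ := hasDerivAt_real_mem_ball_ge hd hz r hp
      exact ⟨D, hD, by rw [if_neg hz]; exact hge⟩
  choose D hD hge using key
  refine ⟨∑ z ∈ box d r, D z, ?_, ?_⟩
  · exact HasDerivAt.fun_sum (u := box d r) (A := fun z q => (bondPercolation (zdGraph d) (PR q)).real BALL[z, r])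
      (A' := fun z => D z) (x := p) fun z _ => hD z
  · have h0 : (0 : Site d) ∈ box d r := zero_mem_box d r
    have hsplit : SB[PR p, r] - 1 = ∑ z ∈ (box d r).erase 0, (bondPercolation (zdGraph d) (PR p)).real BALL[z, r] := by
      rw [← Finset.add_sum_erase _ _ h0, hzero]; ring
    rw [hsplit, Finset.mul_sum, ← Finset.add_sum_erase _ _ h0]
    have hDz0 : 0 ≤ D 0 := by have := hge 0; rwa [if_pos rfl] at this
    have hrest : ∑ z ∈ (box d r).erase 0, (1 - p) ^ (2 * d - 1) / p * (bondPercolation (zdGraph d) (PR p)).real BALL[z, r] ≤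
        ∑ z ∈ (box d r).erase 0, D z :=
      Finset.sum_le_sum fun z hz => by
        have h := hge z
        rw [if_neg (Finset.ne_of_mem_erase hz)] at h
        linarith
    linarith

/-! ### §3. Integrated forms -/

/-- **`V_q(r) − 1 ≤ (V_p(r) − 1)·exp(−4(p−q)(1−p)^{2d})` for `0 < q ≤ p < 1`** (every `r`, `d ≥ 1`): Grimmett–Piza's integrated
steepness `P_q(A) ≤ P_p(A)·e^{−4(p−q)E_p[H_A]}` for each `A = {z ∈ B_int(0,r)}`, `z ≠ 0`, with `E_p[H_A] ≥ (1−p)^{2d}`.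
[cite: GrimmettRandomCluster2006, Thm. (2.53) eq. (2.56)] -/
theorem sumBall_sub_one_le_mul_exp (hd : 1 ≤ d) (r : ℕ) {q p : ℝ} (hq : 0 < q) (hqp : q ≤ p) (hp : p < 1) :
    SB[PR q, r] - 1 ≤ (SB[PR p, r] - 1) * Real.exp (-4 * (p - q) * (1 - p) ^ (2 * d)) := by
  have hpv : ((PR p : unitInterval) : ℝ) = p := congrArg Subtype.val (Set.projIcc_of_mem zero_le_one ⟨hq.le.trans hqp, hp.le⟩)
  have hzero : ∀ s : ℝ, (bondPercolation (zdGraph d) (PR s)).real BALL[(0 : Site d), r] = 1 := fun s => by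
    have : BALL[(0 : Site d), r] = Set.univ := Set.eq_univ_of_forall fun ω => self_mem_ball _ _ _ _
    rw [this, probReal_univ]
  have h0 : (0 : Site d) ∈ box d r := zero_mem_box d r
  have hE : 0 ≤ Real.exp (-4 * (p - q) * (1 - p) ^ (2 * d)) := (Real.exp_pos _).le
  -- per site `z ≠ 0`
  have key : ∀ z ∈ (box d r).erase 0, (bondPercolation (zdGraph d) (PR q)).real BALL[z, r] ≤
      (bondPercolation (zdGraph d) (PR p)).real BALL[z, r] * Real.exp (-4 * (p - q) * (1 - p) ^ (2 * d)) := by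
    intro z hz
    have hz0 : z ≠ 0 := Finset.ne_of_mem_erase hz
    have h := Steepness.real_le_real_mul_exp (G := zdGraph d) (edgesTouching_box_subset r) (isUpperSet_mem_ball z r)
      (determinedBy_mem_ball_touching z r) hq hqp hp
    refine h.trans (mul_le_mul_of_nonneg_left (Real.exp_le_exp.2 ?_) measureReal_nonneg)
    -- `−4(p−q)·E_p[H] ≤ −4(p−q)(1−p)^{2d}` since `E_p[H] ≥ 1 − P_p ≥ (1−p)^{2d}`
    have hH := meanHamDist_ge_one_sub_real (zdGraph d) (edgesTouching_box_nonempty hd r) BALL[z, r] (PR p)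
    have hfe := real_mem_ball_le_one_sub_pow (d := d) (PR p) hz0 r
    rw [hpv] at hfe
    have hpq : 0 ≤ p - q := by linarith
    nlinarith [hH, hfe, hpq]
  calc SB[PR q, r] - 1 = ∑ z ∈ (box d r).erase 0, (bondPercolation (zdGraph d) (PR q)).real BALL[z, r] := by
        rw [← Finset.add_sum_erase _ _ h0, hzero]; ring
    _ ≤ ∑ z ∈ (box d r).erase 0, (bondPercolation (zdGraph d) (PR p)).real BALL[z, r] * Real.exp (-4 * (p - q) * (1 - p) ^ (2 * d)) :=
        Finset.sum_le_sum key
    _ = (SB[PR p, r] - 1) * Real.exp (-4 * (p - q) * (1 - p) ^ (2 * d)) := by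
        rw [← Finset.sum_mul, ← Finset.add_sum_erase _ _ h0, hzero]; ring

/-- **ABOVE `p_c`: `V_p(r) − 1 ≥ r·exp(4(p−p_c)(1−p)^{2d})`** for `p_c ≤ p < 1`, every `r`, `d ≥ 2` (§3 between `p_c` and `p` with file 2's
`V_{p_c}(r) ≥ r + 1`) — the excess intrinsic volume over the critical floor grows at least exponentially in `p − p_c` (rate
`4(1−p)^{2d}`, uniform in `r`; MF-inexact). [cite: GrimmettRandomCluster2006, Thm. (2.53) eq. (2.56)] -/
theorem sumBall_supercritical_ge_mul_exp (hd : 2 ≤ d) (r : ℕ) (p : unitInterval) (hpc : (criticalProbI d : ℝ) ≤ p) (hp1 : (p : ℝ) < 1) :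
    (r : ℝ) * Real.exp (4 * ((p : ℝ) - criticalProbI d) * (1 - (p : ℝ)) ^ (2 * d)) ≤ SB[p, r] - 1 := by
  have hpc0 : 0 < (criticalProbI d : ℝ) := by rw [coe_criticalProbI]; exact criticalProb_zd_pos d (by omega)
  have h := sumBall_sub_one_le_mul_exp (d := d) (by omega) r hpc0 hpc hp1
  have hPRc : (PR (criticalProbI d : ℝ)) = criticalProbI d := Set.projIcc_val zero_le_one _
  have hPRp : (PR (p : ℝ)) = p := Set.projIcc_val zero_le_one _
  rw [hPRc, hPRp] at h
  have hcrit : (r : ℝ) ≤ SB[criticalProbI d, r] - 1 := by linarith [sumBall_criticalProbI_ge hd r]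
  have hE : 0 < Real.exp (-4 * ((p : ℝ) - criticalProbI d) * (1 - (p : ℝ)) ^ (2 * d)) := Real.exp_pos _
  -- `r ≤ (V_p − 1)·e^{−c}` ⟹ `r·e^{c} ≤ V_p − 1`
  have h2 : (r : ℝ) * Real.exp (4 * ((p : ℝ) - criticalProbI d) * (1 - (p : ℝ)) ^ (2 * d)) ≤
      (SB[p, r] - 1) * Real.exp (-4 * ((p : ℝ) - criticalProbI d) * (1 - (p : ℝ)) ^ (2 * d)) *
        Real.exp (4 * ((p : ℝ) - criticalProbI d) * (1 - (p : ℝ)) ^ (2 * d)) :=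
    mul_le_mul_of_nonneg_right (hcrit.trans h) (Real.exp_pos _).le
  have hexp : Real.exp (-4 * ((p : ℝ) - criticalProbI d) * (1 - (p : ℝ)) ^ (2 * d)) *
      Real.exp (4 * ((p : ℝ) - criticalProbI d) * (1 - (p : ℝ)) ^ (2 * d)) = 1 := by
    rw [← Real.exp_add, show -4 * ((p : ℝ) - criticalProbI d) * (1 - (p : ℝ)) ^ (2 * d) +
      4 * ((p : ℝ) - criticalProbI d) * (1 - (p : ℝ)) ^ (2 * d) = 0 by ring, Real.exp_zero]
  calc (r : ℝ) * Real.exp (4 * ((p : ℝ) - criticalProbI d) * (1 - (p : ℝ)) ^ (2 * d))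
      ≤ (SB[p, r] - 1) * Real.exp (-4 * ((p : ℝ) - criticalProbI d) * (1 - (p : ℝ)) ^ (2 * d)) *
        Real.exp (4 * ((p : ℝ) - criticalProbI d) * (1 - (p : ℝ)) ^ (2 * d)) := h2
    _ = SB[p, r] - 1 := by rw [mul_assoc, hexp, mul_one]

end ChemSphere

end Summit.CriticalPhenomena.PercolationContinuityZ3.Theorems

end
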